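import Literature.Barriers.Schanuel.NesterenkoModularScopeValuesRhoProofs
import Literature.Barriers.Schanuel.NesterenkoModularScopeHolds
import HarnessLib

/-!
# Periods family, wave 0 — proofs: Nesterenko's theorems on `π, e^π, Γ(1/4)` and on `π, e^{π√3}, Γ(1/3)` (`nesterenko`, `nesterenko'`)

Sibling proof file of `PeriodsWave0.lean`. It discharges the two named facts of **periods.S16**
(Nesterenko 1996):

* `Literature.NumberTheory.Transcendental.nesterenko` — **the three numbers `π`, `e^π` and
  `Γ(1/4)` are algebraically independent over `ℚ`** — `nesterenko_holds`;
* `Literature.NumberTheory.Transcendental.nesterenko'` — **the three numbers `π`, `e^{π√3}` and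
  `Γ(1/3)` are algebraically independent over `ℚ`** — `nesterenko'_holds`.

The proofs are the printed ones, LNM 1752 Ch. 3 §1 (p. 27) and Ch. 1 §3 (Corollary 3.2 with
Remark (ii)): both statements are NESTERENKO'S THEOREM 1.1 (for every `q ∈ ℂ` with `0 < |q| < 1`,
`trdeg_ℚ ℚ(q, P(q), Q(q), R(q)) ≥ 3`, Ramanujan's `P, Q, R` being the `q`-series of `E₂, E₄, E₆`)
taken at an elliptic point — at `q = e^{−2π}` (`τ = i`), where "`P(q) = 3/π`,
`Q(q) = 3Γ(1/4)⁸/(2π)⁶`, `R(q) = 0`, see Chapter 1" (Corollary 1.2), resp. at `q = −e^{−π√3}`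
(`τ = ρ = e^{2πi/3}`), where `P(q) = 2√3/π`, `Q(q) = 0`, `R(q) = 27Γ(1/3)¹⁸/(2⁹π¹²)`
(Waldschmidt's Corollary 49) — so that `ℚ(q, P(q), Q(q), R(q))` lies in `ℚ(π, e^π, Γ(1/4))`,
resp. in `ℚ(√3, π, e^{π√3}, Γ(1/3))` with `√3` algebraic, and has transcendence degree `≥ 3`.
All the ingredients are theorems of the tree:

* Theorem 1.1 — `Literature.Barriers.Schanuel.nesterenko1996_thm_1_1_holds`
  (`Barriers/Schanuel/NesterenkoModularScopeHolds.lean`: Philippon's criterion / Nesterenko's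
  elimination-theoretic Props. 4.4, 4.7, 4.8, 4.11, 4.13 and Cors. 4.9, 4.10 of Ch. 3, Lemmas 2.2,
  3.1–3.4 of Ch. 3, Mahler's theorem, the `D`-property Prop. 5.1 and the multiplicity estimate of
  Ch. 10 via its Prop. 3.6);
* the values at `e^{−2π}` and the reduction of Corollary 1.2 to Theorem 1.1 —
  `Literature.Barriers.Schanuel.nesterenko_of_thm_1_1'`
  (`Barriers/Schanuel/NesterenkoModularScopeValuesProofs.lean`: `P(e^{−2π}) = E₂(i) = 3/π`,
  `Q(e^{−2π}) = E₄(i) = 3Γ(1/4)⁸/(2π)⁶` through `℘(1/2) = Γ(1/4)⁴/(8π)` for the lattice `ℤi + ℤ`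
  and the lemniscate integral `∫₁^∞ du/√(u³ − u) = Γ(1/4)²/(2√(2π))`, `R(e^{−2π}) = E₆(i) = 0`;
  `Literature/NumberTheory/EllipticCurves/EisensteinValuesAtI.lean`,
  `Literature/Analysis/SpecialFunctions/LemniscateConstant.lean`);
* the values at `−e^{−π√3}` and the reduction of Corollary 49 to Theorem 1.1 —
  `Literature.Barriers.Schanuel.nesterenko'_of_thm_1_1`
  (`Barriers/Schanuel/NesterenkoModularScopeValuesRhoProofs.lean`: `E₂(ρ) = 2√3/π`, `E₄(ρ) = 0`,
  `E₆(ρ) = 27Γ(1/3)¹⁸/(2⁹π¹²)`; `Literature/NumberTheory/EllipticCurves/EisensteinValuesAtRho.lean`,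
  `EisensteinValuesAtRhoSix.lean`).

A sibling file is used (rather than an append to `PeriodsWave0.lean` or `PeriodsWave0Proofs.lean`)
because the statement file sits below the whole `Barriers/Schanuel/NesterenkoModularScope*` cone in
the import order (`NesterenkoModularScope.lean` states Corollary 1.2 against
`Literature.NumberTheory.Transcendental.nesterenko`).

## References

* [NesterenkoPhilippon2001] Yu. V. Nesterenko, P. Philippon (eds.), *Introduction to Algebraic
  Independence Theory*, Lecture Notes in Math. 1752, Springer 2001: Ch. 3 (Yu. V. Nesterenko,
  *Algebraic independence for values of Ramanujan functions*) §1, Theorem 1.1 and Corollary 1.2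
  (p. 27, PDF p. 39); Ch. 1 (M. Waldschmidt) §3, Corollary 3.2 and Remark (ii) (PDF p. 19).
* [Nesterenko1996SbMath] Yu. V. Nesterenko, *Modular functions and transcendence questions*,
  Mat. Sb. 187:9 (1996), 65–96; Sb. Math. 187 (1996), 1319–1348: Theorem 1 and its corollaries.
* [Waldschmidt2008EllipticSurvey] M. Waldschmidt, *Elliptic functions and transcendence*,
  Surveys in number theory, Dev. Math. 17 (2008), 143–188: §5.6 Theorem 46, Corollaries 48 and 49.
-/

noncomputable section

namespace Literature.NumberTheory.Transcendental

/-- **Nesterenko's theorem (1996), LNM 1752 Ch. 3 Corollary 1.2** (**periods.S16**): the numbers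
`π`, `e^π` and `Γ(1/4)` are algebraically independent over `ℚ` — the discharge of the named fact
`nesterenko`, from Theorem 1.1 (`Literature.Barriers.Schanuel.nesterenko1996_thm_1_1_holds`) at
`q = e^{−2π}` (`Literature.Barriers.Schanuel.nesterenko_of_thm_1_1'`).
[cite: NesterenkoPhilippon2001, Ch. 3 §1 Theorem 1.1 and Corollary 1.2 (p. 27, PDF p. 39)]
[cite: Nesterenko1996SbMath, Theorem 1 and its first corollary]
[cite: Waldschmidt2008EllipticSurvey, §5.6 Corollary 48] -/
theorem nesterenko_holds : nesterenko :=
  Literature.Barriers.Schanuel.nesterenko_of_thm_1_1'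
    Literature.Barriers.Schanuel.nesterenko1996_thm_1_1_holds

/-- **Nesterenko's theorem (1996) at `τ = ρ`, LNM 1752 Ch. 1 Corollary 3.2 (`D = 3`) /
Waldschmidt's Corollary 49** (**periods.S16**): the numbers `π`, `e^{π√3}` and `Γ(1/3)` are
algebraically independent over `ℚ` — the discharge of the named fact `nesterenko'`, from
Theorem 1.1 (`Literature.Barriers.Schanuel.nesterenko1996_thm_1_1_holds`) at `q = −e^{−π√3}`
(`Literature.Barriers.Schanuel.nesterenko'_of_thm_1_1`).
[cite: NesterenkoPhilippon2001, Ch. 1 §3 Corollary 3.2 and Remark (ii) (PDF p. 19); Ch. 3 Theorem 1.1 (PDF p. 39)]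
[cite: Waldschmidt2008EllipticSurvey, §5.6 Corollary 49 (PDF p. 154)]
[cite: Nesterenko1996SbMath, Theorem 1 and its corollaries] -/
theorem nesterenko'_holds : nesterenko' :=
  Literature.Barriers.Schanuel.nesterenko'_of_thm_1_1
    Literature.Barriers.Schanuel.nesterenko1996_thm_1_1_holds

end Literature.NumberTheory.Transcendental

end
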